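import Summits.QuantumFields.BalabanUV.Beta.EriceRemainderEnclosureHistoryAutonomyComparisonAgeCompositionDecayEnd

/-!
# EriceRemainderEnclosureHistoryAutonomyComparisonAgeCompositionDecayHorizon — (E86a) route (N), first order: THE STATIC DECAY FAMILY (S-d) AS A THEOREM
# ALONG TWO-AGE FLOWS, AND THE DAMPED TWO-AGE END FOR EVERY HORIZON — the excess may have ANY depth `N ≥ K`; the pin horizon is no longer tied to the age
# bound

Cell `pub-balaban`, β-function sub-cell, BINDER row D4 «RemainderConst leaves for Bałaban's split» (`HOME/BINDER-OWNERS.md`; owner lineage `b2b-balaban-beta-an4`;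
this file by co-owner #2 lineage `b2b-balaban-beta-d4-p2`, generation 77), β-FLOW TEAM duty (1), FREEZE (0) honoured (def-free; imports (E85f) `…DecayEnd`;
uses (E83j) `nonneg_of_static_families_decay`, (E84a) `Hg_one_le` ∕ `static_decay_of_product`, (E84b) `flow_product_of_linear_budget`, (E85f)
`budget_along_flow`, (E82c) `flow_hSb_one` BY NAME; nothing restated).  Closes successor item (4) «general horizon» of README
`HOME/b2b-balaban-beta-d4-p2/g74/e83/README.md` §4 for the two-age END.

HONEST FRAMING (page 1, verbatim and binding).  *"Discharging BetaPertH makes Bałaban's UV stability UNCONDITIONAL — a real constructive-QFT result; it is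
NOT the continuum limit and NOT the Clay problem."*  THIS FILE DISCHARGES NOTHING OF THE KIND.  Elementary real analysis about ABSTRACT functionals on a box
]0,γ]^ℕ with displayed floors, profiles and signs, and the FIRST-ORDER renewal objects of route (N) built from them — hypotheses of a census, not facts; the
form, signs, ages and moments of Bałaban's (1.22) limit functional are NOT PRINTED ([I] p. 298; GAPS G-t4-U2-1∕-2) and NOT asserted.  Row D4 class
UNCHANGED (critical-path width 0; instance 0∕1; D4 DISCHARGE NO DATE).  HONEST DEPENDENCY: continuum YM on T⁴ ⇐ BetaPertH ∧ nine spine estimates (0/9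
proved); BetaPertH ⇐ (D1) ∧ (D4) ∧ CAP+tail; G-an2-4 gates asym, D1 and NE2/3/4.

THE POINT (census sense (α); route (N); README `HOME/b2b-balaban-beta-d4-p2/g77/e86/README.md`).  The static END (E83j) `nonneg_of_static_families_decay`
is stated for an arbitrary horizon `N` (the depth beyond which the admissible excess vanishes; every window length `y_i ≤ N`); the flow wrappers (E83k) →
(E84a) → (E84b) → (E85f) instantiated it at `N = K = k+1` only, so the hypothesis-free two-age END (E85f) `flow_nonneg_two_ages` covered excesses of depth
`≤ k+1` — ONE window of the old age; the critical∕deep regime of (E83a)'s entering-lag trichotomy then occurs at the top pin only.  Here the tie is cut.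
§1 **`flow_static_decay`**: THE STATIC DECAY FAMILY (S-d) IS A THEOREM ALONG EVERY TWO-AGE FLOW — for the two-age profile `{1, k}` (`2 ≤ k`, `K = k+1`), `h` a
box solution of an isotone memory `B` with floor `b > 0` dominated by `L ≥ 0`, ANY damping `g` with `1∕(1+F_t) ≤ g_t ≤ 1`, at EVERY pin `m`:
`KL k (m+1) (k−1)·KL 1 (m+1+k) 0·Π_{p∈[m+2,m+2+k)} Hg 1 p ≤ KL k m 0·KL 1 (m+1) 0·(1 − KL 1 (m+2) 0·Hg 1 (m+2))` ((E85f) `budget_along_flow` → (E84b)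
`flow_product_of_linear_budget` → (E84a) `static_decay_of_product` with `Hg_one_le`; so far this composition lived only inside (E85f)'s END).  §2 two pieces of
bookkeeping (`sum_range_of_le`, `aggregate_eq_zero_of_horizon`: lone and aggregate kernels vanish at lags `≥ K`, so every `range K` read is a `range N` read) and
**`flow_nonneg_of_static_families_decay_horizon`**: (E83k) `flow_nonneg_of_static_families_decay` with the truncation horizon `N ≥ K` SEPARATED from the age
bound `K` (reads, ratio and tail-sum letters keep their `range K` ∕ `range (K−1)` displays; the admissible excess, its surplus and the solution operators are
truncated at `N`; the top family (S-c♯) is passed in (E83j)'s `N`-form).  §3 **`flow_nonneg_two_ages_horizon`**: ROUTE (N), FIRST ORDER, THE DAMPED TWO-AGE END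
FOR EVERY HORIZON, NO STATIC HYPOTHESIS — as (E85f) `flow_nonneg_two_ages` but for every `N ≥ K`: the comparison surplus `ε` of every admissible excess `e` of
ANY depth (`e ≥ 0` non-increasing, `e_m = 0` for `m > N`) is non-negative at every pin.  NUMERICS OF RECORD: those of (E85f) (the (S-d) margins are per pin and
horizon-free).  NOT CLAIMED: three or more loaded ages; dampings outside the relaxed class; anything nonlinear; anything printed — in particular NOT B12 Thm 2,
NOT BetaPertH.

WHAT IS PROVED ([folklore]; 0 `def`, 0 sorry).  §1 **`flow_static_decay`**; §2 `sum_range_of_le`, `aggregate_eq_zero_of_horizon`,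
**`flow_nonneg_of_static_families_decay_horizon`**; §3 **`flow_nonneg_two_ages_horizon`**.
-/
noncomputable section
open Finset

namespace Summit.QuantumFields.BalabanUV.Beta.EriceRemainderEnclosureHistoryAutonomyComparisonAgeCompositionDecayHorizon

open Literature.MathematicalPhysics.QuantumFieldTheory.Balaban1983to89
open Literature.MathematicalPhysics.QuantumFieldTheory.Balaban1983to89.T4BetaStationary
open Literature.MathematicalPhysics.QuantumFieldTheory.Balaban1983to89.T4BetaFlowWellPosed
open Summit.QuantumFields.BalabanUV.Beta.EriceRemainderEnclosureHistoryAutonomyOrder (strictAnti_of_memFlow)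
open Summit.QuantumFields.BalabanUV.Beta.EriceRemainderEnclosureHistoryAutonomyComparisonAgeCompositionIdentification
open Summit.QuantumFields.BalabanUV.Beta.EriceRemainderEnclosureHistoryAutonomyComparisonAgeCompositionChainWiring (aggregate_eq_sum)
open Summit.QuantumFields.BalabanUV.Beta.EriceRemainderEnclosureHistoryAutonomyComparisonAgeCompositionChainWiringAtPin (age_chain_closes)
open Summit.QuantumFields.BalabanUV.Beta.EriceRemainderEnclosureHistoryAutonomyComparisonAgeCompositionCriteriaFlow (flow_shift_domination)
open Summit.QuantumFields.BalabanUV.Beta.EriceRemainderEnclosureHistoryAutonomyComparisonAgeCompositionStaticEndFlow (flow_lag_zero_mass_lt_one)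
open Summit.QuantumFields.BalabanUV.Beta.EriceRemainderEnclosureHistoryAutonomyComparisonAgeCompositionStaticEndOldestFlow (silent_tail_sums)
open Summit.QuantumFields.BalabanUV.Beta.EriceRemainderEnclosureHistoryAutonomyComparisonAgeCompositionStaticEndDecay (nonneg_of_static_families_decay)
open Summit.QuantumFields.BalabanUV.Beta.EriceRemainderEnclosureHistoryAutonomyComparisonAgeCompositionYoungestTailSumWiring (flow_hSb_one kernel_zero)
open Summit.QuantumFields.BalabanUV.Beta.EriceRemainderEnclosureHistoryAutonomyComparisonAgeCompositionDecayReduction (Hg_one_le static_decay_of_product)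
open Summit.QuantumFields.BalabanUV.Beta.EriceRemainderEnclosureHistoryAutonomyComparisonAgeCompositionDecayBudget (flow_product_of_linear_budget)
open Summit.QuantumFields.BalabanUV.Beta.EriceRemainderEnclosureHistoryAutonomyComparisonAgeCompositionDecayEnd (budget_along_flow)

variable {B : (ℕ → ℝ) → ℝ} {γ b gIR : ℝ} {L : ℕ → ℝ} {K : ℕ} {h g : ℕ → ℝ} {KL : ℕ → ℕ → ℕ → ℝ}

/-! ## §1 The static decay family (S-d) along two-age flows, as a theorem -/

/-- **(S-d) HOLDS ALONG EVERY TWO-AGE FLOW, EVERY DAMPING OF THE RELAXED CLASS, AT EVERY PIN.**  Two-age profile `{1, k}` (`2 ≤ k`, `K = k+1`), `h` a box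
solution of an isotone memory with floor `b > 0` dominated by `L ≥ 0`, `g` any damping with `1∕(1+F_t) ≤ g_t ≤ 1`, the lone kernels `KL`, defects `θ`, chain
letters `ρ`, `β` and growth factors `Hg` of route (N) as displayed.  Then at every pin `m`:
`KL k (m+1) (k−1)·KL 1 (m+1+k) 0·Π_{p∈[m+2,m+2+k)} Hg 1 p ≤ KL k m 0·KL 1 (m+1) 0·(1 − KL 1 (m+2) 0·Hg 1 (m+2))`.
Composition of (E85f) `budget_along_flow`, (E84b) `flow_product_of_linear_budget`, (E84a) `Hg_one_le` and `static_decay_of_product`. [folklore] -/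
theorem flow_static_decay (hmono : ∀ u v : ℕ → ℝ, SeqBox γ u → SeqBox γ v → (∀ j, u j ≤ v j) → B u ≤ B v)
    (hL : ∀ k, 0 ≤ L k) (hb : 0 < b) (hlo : ∀ u, SeqBox γ u → b ≤ B u) (hdom : ∀ u, SeqBox γ u → ∑ k ∈ range K, L k * u k ≤ B u)
    (hh : SeqBox γ h) (hf : MemFlow B gIR h)
    (hg : ∀ t, 0 < g t ∧ g t ≤ 1) (hgF : ∀ t, 1 / (1 + ∑ k ∈ range K, L k * h (t + k) ^ 3 / 2) ≤ g t)
    {k : ℕ} (hk2 : 2 ≤ k) (hKk : K = k + 1) (hL2 : ∀ j, j < K → j ≠ 1 → j ≠ k → L j = 0)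
    (hKL : ∀ k n l, KL k n l = if 0 < k ∧ k < K ∧ l < k then L k * h (n + k) ^ 3 / 2 * ∏ t ∈ Ico (n + 1 + l) (n + k + 1), g t else 0)
    {θ : ℕ → ℕ → ℕ → ℝ} (hθ : ∀ k n l, θ k n l = 1 - (h (n + k + l) / h (n + k)) ^ 3 * ∏ t ∈ Ico (n + k + 1) (n + k + l + 1), g t)
    {ρ : ℕ → ℕ → ℝ} {β : ℕ → ℕ → ℕ → ℝ}
    (hρ : ∀ i n, 1 ≤ i → i ≤ K - 1 → ρ i n = (∑ l ∈ range K, KL i n l) * (1 + ∑ k ∈ Ioc i (K - 1), θ k n i * β (i + 1) n k) /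
      (1 - ∑ k ∈ Ioc i (K - 1), ∑ l ∈ range i, KL k n l))
    (hβnew : ∀ i n, 1 ≤ i → i ≤ K - 1 → β i n i = ρ i n / (1 - ρ i n))
    (hβold : ∀ i n k, 1 ≤ i → i < k → k ≤ K - 1 → β i n k = β (i + 1) n k / (1 - ρ i n))
    {Hg : ℕ → ℕ → ℝ} (hH : ∀ i m, Hg i m = (1 + ∑ k ∈ Ioc i (K - 1), θ k m 1 * β (i + 1) m k) / (1 - ∑ k ∈ Ioc i (K - 1), KL k m 0))
    (m : ℕ) :
    KL k (m + 1) (k - 1) * KL 1 (m + 1 + k) 0 * ∏ p ∈ Ico (m + 2) (m + 2 + k), Hg 1 p ≤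
      KL k m 0 * KL 1 (m + 1) 0 * (1 - KL 1 (m + 2) 0 * Hg 1 (m + 2)) := by
  have hkK : k < K := by omega
  -- the linearised budget at the pin `m` ((E85f)), in the displayed coefficient letters
  have hB := budget_along_flow hmono hL hb hlo hdom hh hf hk2 hKk hL2 (c := fun n => L k * h (n + k) ^ 3 / 2)
    (d := fun n => L 1 * h (n + 1) ^ 3 / 2) (F := fun t => ∑ j ∈ range K, L j * h (t + j) ^ 3 / 2)
    (Hup := fun p => (1 + (1 - (h (p + k + 1) / h (p + k)) ^ 3 / (1 + ∑ j ∈ range K, L j * h (p + k + 1 + j) ^ 3 / 2))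
      * ((k * (L k * h (p + k) ^ 3 / 2)) / (1 - k * (L k * h (p + k) ^ 3 / 2)))) / (1 - L k * h (p + k) ^ 3 / 2))
    (fun _ => rfl) (fun _ => rfl) (fun _ => rfl) (fun _ => rfl) m
  -- the growth factors of the chain are dominated by their displayed majorants ((E84a) `Hg_one_le`)
  have hHg := fun (p : ℕ) (hp : 1 ≤ p) =>
    Hg_one_le hmono hL hb hlo hdom hh hf hg hgF hk2 hkK hL2 hKL hθ hρ hβnew hβold hH (c := fun n => L k * h (n + k) ^ 3 / 2)
      (F := fun t => ∑ j ∈ range K, L j * h (t + j) ^ 3 / 2)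
      (Hup := fun p => (1 + (1 - (h (p + k + 1) / h (p + k)) ^ 3 / (1 + ∑ j ∈ range K, L j * h (p + k + 1 + j) ^ 3 / 2))
        * ((k * (L k * h (p + k) ^ 3 / 2)) / (1 - k * (L k * h (p + k) ^ 3 / 2)))) / (1 - L k * h (p + k) ^ 3 / 2))
      (fun _ => rfl) (fun _ => rfl) (fun _ => rfl) hp
  -- (★) from the budget ((E84b)), then (S-d) from (★) ((E84a))
  exact static_decay_of_product hL hh hg hgF hk2 hkK hKL (Hg := Hg) (c := fun n => L k * h (n + k) ^ 3 / 2)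
    (d := fun n => L 1 * h (n + 1) ^ 3 / 2) (F := fun t => ∑ j ∈ range K, L j * h (t + j) ^ 3 / 2)
    (Hup := fun p => (1 + (1 - (h (p + k + 1) / h (p + k)) ^ 3 / (1 + ∑ j ∈ range K, L j * h (p + k + 1 + j) ^ 3 / 2))
      * ((k * (L k * h (p + k) ^ 3 / 2)) / (1 - k * (L k * h (p + k) ^ 3 / 2)))) / (1 - L k * h (p + k) ^ 3 / 2))
    (fun _ => rfl) (fun _ => rfl) (fun _ => rfl)
    (fun p hp => (hHg p (by rw [mem_Ico] at hp; omega)).1) (fun p hp => (hHg p (by rw [mem_Ico] at hp; omega)).2)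
    (by linarith [hB.1])
    (flow_product_of_linear_budget hmono hL hb hlo hdom hh hf hk2 hkK (c := fun n => L k * h (n + k) ^ 3 / 2)
      (d := fun n => L 1 * h (n + 1) ^ 3 / 2) (F := fun t => ∑ j ∈ range K, L j * h (t + j) ^ 3 / 2)
      (Hup := fun p => (1 + (1 - (h (p + k + 1) / h (p + k)) ^ 3 / (1 + ∑ j ∈ range K, L j * h (p + k + 1 + j) ^ 3 / 2))
        * ((k * (L k * h (p + k) ^ 3 / 2)) / (1 - k * (L k * h (p + k) ^ 3 / 2)))) / (1 - L k * h (p + k) ^ 3 / 2))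
      (fun _ => rfl) (fun _ => rfl) (fun _ => rfl) (fun _ => rfl) hB.1 hB.2)

/-! ## §2 The END of (E83j) for the flow, with the horizon separated from the age bound -/

/-- Extending a `range K` sum to `range N` (`K ≤ N`) when the summand vanishes from `K` on. [folklore] -/
theorem sum_range_of_le {f : ℕ → ℝ} {K N : ℕ} (hKN : K ≤ N) (hf : ∀ l, K ≤ l → f l = 0) :
    ∑ l ∈ range K, f l = ∑ l ∈ range N, f l :=
  sum_subset (range_subset_range.mpr hKN) fun l _ hlK => hf l (by rw [mem_range, not_lt] at hlK; exact hlK)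

/-- THE AGGREGATE KERNEL VANISHES AT LAGS BEYOND THE AGE BOUND: if `KA i = KL i + KA (i+1)` with `KA K ≡ 0`, and the lone kernels vanish at lags `≥ K` and
for ages `≥ K`, then `KA i m l = 0` for every `i` and every `l ≥ K` (below the top by (E80b) `aggregate_eq_sum`, above it by induction). [folklore] -/
theorem aggregate_eq_zero_of_horizon {KA : ℕ → ℕ → ℕ → ℝ} (hKA : ∀ i m l, KA i m l = KL i m l + KA (i + 1) m l)
    (hKAtop : ∀ m l, KA K m l = 0) (hKLK : ∀ i m l, K ≤ l → KL i m l = 0) (hKLtop : ∀ i m l, K ≤ i → KL i m l = 0)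
    (i m l : ℕ) (hl : K ≤ l) : KA i m l = 0 := by
  rcases Nat.lt_or_ge i K with hi | hi
  · obtain ⟨n, hn⟩ : ∃ n, K = n + 1 := ⟨K - 1, by omega⟩
    subst hn
    rw [aggregate_eq_sum hKA hKAtop (by omega)]
    exact sum_eq_zero fun k _ => hKLK k m l hl
  · obtain ⟨j, rfl⟩ : ∃ j, i = K + j := ⟨i - K, by omega⟩
    clear hi
    induction j with
    | zero => exact hKAtop m l
    | succ j ih =>
      have h1 := hKA (K + j) m l
      rw [ih, hKLtop (K + j) m l (by omega), show K + j + 1 = K + (j + 1) by omega] at h1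
      linarith

/-- **ROUTE (N), FIRST ORDER, END FOR THE FLOW — (S-a) OPTIONAL PER PAIR, GENERAL HORIZON.**  As (E83k) `flow_nonneg_of_static_families_decay` with the
truncation horizon `N` of the admissible excess SEPARATED from the age bound `K` (`K ≤ N`): the reads `RL`, `RA`, the ratio letters `ρ` and the tail-sum letters
`M` keep their `range K` ∕ `range (K−1)` displays, the solution operators `SL`, `SA`, the excess `e` and its surplus `ε` are truncated at `N`, and the top
family (S-c♯) (`hSc`, `hScp`, only asked at `P`-levels) is passed in (E83j)'s `N`-form.  Instantiates (E83j) `nonneg_of_static_families_decay` at this `N`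
(every lone∕aggregate kernel vanishes at lags `≥ K`, so the displays agree). [folklore] -/
theorem flow_nonneg_of_static_families_decay_horizon (hmono : ∀ u v : ℕ → ℝ, SeqBox γ u → SeqBox γ v → (∀ j, u j ≤ v j) → B u ≤ B v)
    (hL : ∀ k, 0 ≤ L k) (hb : 0 < b) (hlo : ∀ u, SeqBox γ u → b ≤ B u) (hdom : ∀ u, SeqBox γ u → ∑ k ∈ range K, L k * u k ≤ B u)
    (hh : SeqBox γ h) (hf : MemFlow B gIR h)
    (hg : ∀ t, 0 < g t ∧ g t ≤ 1) (hgF : ∀ t, 1 / (1 + ∑ k ∈ range K, L k * h (t + k) ^ 3 / 2) ≤ g t) (hK : 2 ≤ K) {N : ℕ} (hKN : K ≤ N)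
    (hKL : ∀ k n l, KL k n l = if 0 < k ∧ k < K ∧ l < k then L k * h (n + k) ^ 3 / 2 * ∏ t ∈ Ico (n + 1 + l) (n + k + 1), g t else 0)
    {θ : ℕ → ℕ → ℕ → ℝ} (hθ : ∀ k n l, θ k n l = 1 - (h (n + k + l) / h (n + k)) ^ 3 * ∏ t ∈ Ico (n + k + 1) (n + k + l + 1), g t)
    {KA : ℕ → ℕ → ℕ → ℝ} {RL RA SL SA : ℕ → (ℕ → ℝ) → ℕ → ℝ}
    (hRL : ∀ i v m, RL i v m = ∑ l ∈ range K, KL i m l * v (m + 1 + l))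
    (hRA : ∀ i v m, RA i v m = ∑ l ∈ range K, KA i m l * v (m + 1 + l))
    (hKA : ∀ i m l, KA i m l = KL i m l + KA (i + 1) m l) (hKAtop : ∀ m l, KA K m l = 0)
    (hSL : ∀ i (w : ℕ → ℝ), (∀ m, N < m → w m = 0) → (∀ m, N < m → SL i w m = 0) ∧ ∀ m, SL i w m = w m - RL i (SL i w) m)
    (hSA : ∀ i (w : ℕ → ℝ), (∀ m, N < m → w m = 0) → (∀ m, N < m → SA i w m = 0) ∧ ∀ m, SA i w m = w m - RA i (SA i w) m)
    {ρ : ℕ → ℕ → ℝ} {β : ℕ → ℕ → ℕ → ℝ}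
    (hρ : ∀ i n, 1 ≤ i → i ≤ K - 1 → ρ i n = (∑ l ∈ range K, KL i n l) * (1 + ∑ k ∈ Ioc i (K - 1), θ k n i * β (i + 1) n k) /
      (1 - ∑ k ∈ Ioc i (K - 1), ∑ l ∈ range i, KL k n l))
    (hβnew : ∀ i n, 1 ≤ i → i ≤ K - 1 → β i n i = ρ i n / (1 - ρ i n))
    (hβold : ∀ i n k, 1 ≤ i → i < k → k ≤ K - 1 → β i n k = β (i + 1) n k / (1 - ρ i n))
    {Hg : ℕ → ℕ → ℝ} (hH : ∀ i m, Hg i m = (1 + ∑ k ∈ Ioc i (K - 1), θ k m 1 * β (i + 1) m k) / (1 - ∑ k ∈ Ioc i (K - 1), KL k m 0))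
    (hMONOopt : ∀ i k, 1 ≤ i → i < k → k ≤ K - 1 →
      (∀ m M', ∑ l ∈ range (M' + 1), KL k (m + 1) l ≤ ∑ l ∈ range (M' + 2), KL k m l) ∨ (∀ m l, KL i m l = 0) ∨
      (i = 1 ∧ ∀ m, KL k (m + 1) (k - 1) * KL i (m + 1 + k) 0 * ∏ p ∈ Ico (m + 2) (m + 2 + k), Hg i p ≤
        KL k m 0 * KL i (m + 1) 0 * (1 - KL i (m + 2) 0 * Hg i (m + 2))))
    {M : ℕ → ℕ → ℝ} (hM : ∀ i m, M i m = KL i m 0 + ∑ l ∈ range (K - 1), max (KL i m (l + 1) - KL i (m + 1) l) 0)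
    (hSb : ∀ i m, 1 ≤ i → i < K - 1 → ∀ L', L' < i →
      (1 + M i m) * ∑ l ∈ Ico L' i, Hg i (m + 1 + l) * KL i (m + 1) l ≤ ∑ l ∈ Ico L' i, KL i m l)
    (hSbp : ∀ i m, 1 ≤ i → i < K - 1 → ∀ L₀, L₀ < i → ∀ L', L' ≤ L₀ →
      (1 + M i m) * ∑ l ∈ Ico L' L₀, Hg i (m + 1 + l) * KL i (m + 1) l ≤ ∑ l ∈ Ico L' (L₀ + 1), KL i m l)
    {HgS : ℕ → ℕ → ℕ → ℝ} (hHS : ∀ i j m, HgS i j m = (1 + ∑ k ∈ Ioc i (K - 1), θ k m 1 * β (i + 1) m k) /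
      (1 - ∑ k ∈ Ioc i (K - 1), (KL k m 0 - if m + 1 + k ≤ j then KL k (m + 1) (k - 1) else 0)))
    {P : ℕ → Prop} (hlev : ∀ i, 1 ≤ i → i < K - 1 → i = 1 ∨ (∀ m l, KL i m l = 0) ∨ P (i + 1))
    (hSc : ∀ i m j, 1 ≤ i → i ≤ K - 1 → P i → m + 1 + N ≤ j → ∀ L', L' < N →
      ∑ l ∈ Ico L' N, HgS (i - 1) j (m + 1 + l) * KA i (m + 1) l ≤ ∑ l ∈ Ico L' N, KA i m l)
    (hScp : ∀ i m L₀, 1 ≤ i → i ≤ K - 1 → P i → L₀ < N → ∀ L', L' ≤ L₀ →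
      ∑ l ∈ Ico L' L₀, HgS (i - 1) (m + 1 + L₀) (m + 1 + l) * KA i (m + 1) l ≤ ∑ l ∈ Ico L' (L₀ + 1), KA i m l)
    {e ε : ℕ → ℝ} (he0 : ∀ m, 0 ≤ e m) (hea : ∀ m, e (m + 1) ≤ e m) (het : ∀ m, N < m → e m = 0)
    (hεt : ∀ m, N < m → ε m = 0) (hεrec : ∀ m, ε m = e m - RA 1 ε m) : ∀ m, 0 ≤ ε m := by
  have hh0 : ∀ n, 0 < h n := fun n => (hh n).1
  have hanti := (strictAnti_of_memFlow hb hlo hh hf).antitone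
  have hac := fun n i (hi1 : 1 ≤ i) (hiK : i ≤ K - 1) =>
    age_chain_closes hmono hL hb hlo hdom hh hf hg hgF hKL hθ hρ hβnew hβold n hi1 hiK
  -- lone kernels vanish at lags `l` with `K ≤ l + 1` and for ages `≥ K`; aggregate kernels vanish at lags `≥ K`
  have hKLK : ∀ i m l, K ≤ l + 1 → KL i m l = 0 := fun i m l hl => by rw [hKL, if_neg (by omega)]
  have hKLtop : ∀ i m l, K ≤ i → KL i m l = 0 := fun i m l hi => by rw [hKL, if_neg (by omega)]
  have hKA0 : ∀ i m l, K ≤ l → KA i m l = 0 :=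
    aggregate_eq_zero_of_horizon hKA hKAtop (fun i m l hl => hKLK i m l (by omega)) hKLtop
  -- the displays re-read on `range N`
  have hRL' : ∀ i v m, RL i v m = ∑ l ∈ range N, KL i m l * v (m + 1 + l) := fun i v m => by
    rw [hRL]; exact sum_range_of_le hKN fun l hl => by rw [hKLK i m l (by omega), zero_mul]
  have hRA' : ∀ i v m, RA i v m = ∑ l ∈ range N, KA i m l * v (m + 1 + l) := fun i v m => by
    rw [hRA]; exact sum_range_of_le hKN fun l hl => by rw [hKA0 i m l hl, zero_mul]
  have hρ' : ∀ i n, 1 ≤ i → i ≤ K - 1 → ρ i n = (∑ l ∈ range N, KL i n l) * (1 + ∑ k ∈ Ioc i (K - 1), θ k n i * β (i + 1) n k) /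
      (1 - ∑ k ∈ Ioc i (K - 1), ∑ l ∈ range i, KL k n l) := fun i n hi1 hiK => by
    rw [hρ i n hi1 hiK, sum_range_of_le hKN fun l hl => hKLK i n l (by omega)]
  have hM' : ∀ i m, M i m = KL i m 0 + ∑ l ∈ range (N - 1), max (KL i m (l + 1) - KL i (m + 1) l) 0 := fun i m => by
    rw [hM, sum_range_of_le (show K - 1 ≤ N - 1 by omega) fun l hl => by
      rw [hKLK i m (l + 1) (by omega), hKLK i (m + 1) l (by omega), sub_zero, max_self]]
  exact nonneg_of_static_families_decay (N := N) (n := K - 1) (y := fun i => i) (KL := KL) (θ := θ)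
    (weight_nonneg hL hh0 hg hKL) (fun i m l hl => hKLK i m l (by omega))
    (fun i m l hl => by rw [hKL, if_neg (fun h3 => by omega)])
    hRL' hRA' hKA (fun m l => by rw [Nat.sub_add_cancel (by omega : 1 ≤ K)]; exact hKAtop m l) hSL hSA
    (fun i hi1 hiK => ⟨hi1, by omega⟩)
    (defect_nonneg hh0 hanti hg hθ) (persistence hL hh0 hg hKL hθ) (fun k m l l' hll' => defect_mono hh0 hanti hg hθ k m hll')
    hρ' hβnew hβold (fun i m hi1 hiK => (hac m i hi1 hiK).2) (fun i m hi1 hiK => (hac m i hi1 hiK).1)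
    (fun k m l hl => flow_shift_domination hL hh0 hanti hg hKL k m l hl)
    (fun i m _ => flow_lag_zero_mass_lt_one hmono hL hb hlo hdom hh hf hg hKL i m) hH hMONOopt hM' hSb hSbp hHS hlev hSc hScp
    he0 hea het hεt hεrec

/-! ## §3 The damped two-age END for every horizon, no static hypothesis -/

/-- **ROUTE (N), FIRST ORDER, END FOR TWO-AGE FLOWS, EVERY DAMPING OF THE RELAXED CLASS, EVERY HORIZON, NO STATIC HYPOTHESIS.**  As (E85f)
`flow_nonneg_two_ages` with the horizon freed: two-age profile `{1, k}` (`2 ≤ k`, `K = k+1`), `h` a box solution of an isotone memory `B` with floor `b > 0`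
dominated by `L ≥ 0`, ANY damping `g` with `1∕(1+F_t) ≤ g_t ≤ 1`, the first-order objects of route (N) as displayed, and ANY horizon `N ≥ K`: the comparison
surplus `ε` of every admissible excess `e` (`e ≥ 0`, non-increasing, `e_m = 0` for `m > N`) is non-negative at every pin.  (S-d) by §1 `flow_static_decay`, the
age-1 tail sums (S-b) by (E82c) `flow_hSb_one`, the silent ages trivially, the horizon by §2. [folklore] -/
theorem flow_nonneg_two_ages_horizon (hmono : ∀ u v : ℕ → ℝ, SeqBox γ u → SeqBox γ v → (∀ j, u j ≤ v j) → B u ≤ B v)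
    (hL : ∀ k, 0 ≤ L k) (hb : 0 < b) (hlo : ∀ u, SeqBox γ u → b ≤ B u) (hdom : ∀ u, SeqBox γ u → ∑ k ∈ range K, L k * u k ≤ B u)
    (hh : SeqBox γ h) (hf : MemFlow B gIR h)
    (hg : ∀ t, 0 < g t ∧ g t ≤ 1) (hgF : ∀ t, 1 / (1 + ∑ k ∈ range K, L k * h (t + k) ^ 3 / 2) ≤ g t)
    {k : ℕ} (hk2 : 2 ≤ k) (hKk : K = k + 1) (hL2 : ∀ j, j < K → j ≠ 1 → j ≠ k → L j = 0) {N : ℕ} (hKN : K ≤ N)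
    (hKL : ∀ k n l, KL k n l = if 0 < k ∧ k < K ∧ l < k then L k * h (n + k) ^ 3 / 2 * ∏ t ∈ Ico (n + 1 + l) (n + k + 1), g t else 0)
    {θ : ℕ → ℕ → ℕ → ℝ} (hθ : ∀ k n l, θ k n l = 1 - (h (n + k + l) / h (n + k)) ^ 3 * ∏ t ∈ Ico (n + k + 1) (n + k + l + 1), g t)
    {KA : ℕ → ℕ → ℕ → ℝ} {RL RA SL SA : ℕ → (ℕ → ℝ) → ℕ → ℝ}
    (hRL : ∀ i v m, RL i v m = ∑ l ∈ range K, KL i m l * v (m + 1 + l))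
    (hRA : ∀ i v m, RA i v m = ∑ l ∈ range K, KA i m l * v (m + 1 + l))
    (hKA : ∀ i m l, KA i m l = KL i m l + KA (i + 1) m l) (hKAtop : ∀ m l, KA K m l = 0)
    (hSL : ∀ i (w : ℕ → ℝ), (∀ m, N < m → w m = 0) → (∀ m, N < m → SL i w m = 0) ∧ ∀ m, SL i w m = w m - RL i (SL i w) m)
    (hSA : ∀ i (w : ℕ → ℝ), (∀ m, N < m → w m = 0) → (∀ m, N < m → SA i w m = 0) ∧ ∀ m, SA i w m = w m - RA i (SA i w) m)
    {ρ : ℕ → ℕ → ℝ} {β : ℕ → ℕ → ℕ → ℝ}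
    (hρ : ∀ i n, 1 ≤ i → i ≤ K - 1 → ρ i n = (∑ l ∈ range K, KL i n l) * (1 + ∑ k ∈ Ioc i (K - 1), θ k n i * β (i + 1) n k) /
      (1 - ∑ k ∈ Ioc i (K - 1), ∑ l ∈ range i, KL k n l))
    (hβnew : ∀ i n, 1 ≤ i → i ≤ K - 1 → β i n i = ρ i n / (1 - ρ i n))
    (hβold : ∀ i n k, 1 ≤ i → i < k → k ≤ K - 1 → β i n k = β (i + 1) n k / (1 - ρ i n))
    {Hg : ℕ → ℕ → ℝ} (hH : ∀ i m, Hg i m = (1 + ∑ k ∈ Ioc i (K - 1), θ k m 1 * β (i + 1) m k) / (1 - ∑ k ∈ Ioc i (K - 1), KL k m 0))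
    {M : ℕ → ℕ → ℝ} (hM : ∀ i m, M i m = KL i m 0 + ∑ l ∈ range (K - 1), max (KL i m (l + 1) - KL i (m + 1) l) 0)
    {HgS : ℕ → ℕ → ℕ → ℝ} (hHS : ∀ i j m, HgS i j m = (1 + ∑ k ∈ Ioc i (K - 1), θ k m 1 * β (i + 1) m k) /
      (1 - ∑ k ∈ Ioc i (K - 1), (KL k m 0 - if m + 1 + k ≤ j then KL k (m + 1) (k - 1) else 0)))
    {e ε : ℕ → ℝ} (he0 : ∀ m, 0 ≤ e m) (hea : ∀ m, e (m + 1) ≤ e m) (het : ∀ m, N < m → e m = 0)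
    (hεt : ∀ m, N < m → ε m = 0) (hεrec : ∀ m, ε m = e m - RA 1 ε m) : ∀ m, 0 ≤ ε m := by
  have hkK : k < K := by omega
  have hSd := flow_static_decay hmono hL hb hlo hdom hh hf hg hgF hk2 hKk hL2 hKL hθ hρ hβnew hβold hH
  obtain ⟨h1, h1p⟩ := flow_hSb_one hmono hL hb hlo hdom hh hf hg hgF hk2 hkK hL2 hKL hθ hρ hβnew hβold hH hM
  refine flow_nonneg_of_static_families_decay_horizon hmono hL hb hlo hdom hh hf hg hgF (by omega) hKN hKL hθ hRL hRA hKA hKAtop hSL hSA hρ hβnew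
    hβold hH (fun i k' hi1 hik' hk'K => ?_) hM (fun i m hi1 hiK L' hL' => ?_) (fun i m hi1 hiK L₀ hL₀ L' hL' => ?_) hHS (P := fun _ => False)
    (fun i hi1 hiK => ?_) (fun i m j _ _ hP => hP.elim) (fun i m L₀ _ _ hP => hP.elim) he0 hea het hεt hεrec
  · -- the per-pair options: (1, k) by (S-d) (§1); (1, k') with k' silent by (trivial) cumulative domination; (i ≥ 2, ·) silent young level
    rcases Nat.lt_or_ge i 2 with hi | hi
    · by_cases hkk : k' = k
      · subst hkk; exact Or.inr (Or.inr ⟨by omega, by rw [show i = 1 by omega]; exact hSd⟩)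
      · refine Or.inl fun m M' => ?_
        have hz := kernel_zero hKL (hL2 k' (by omega) (by omega) hkk)
        rw [sum_eq_zero fun l _ => hz _ _, sum_eq_zero fun l _ => hz _ _]
    · exact Or.inr (Or.inl fun m l => kernel_zero hKL (hL2 i (by omega) (by omega) (by omega)) m l)
  · rcases Nat.lt_or_ge i 2 with hi | hi
    · obtain rfl : i = 1 := by omega
      exact h1 m L' hL'
    · exact silent_tail_sums hKL (hL2 i (by omega) (by omega) (by omega)) m _ _
  · rcases Nat.lt_or_ge i 2 with hi | hi
    · obtain rfl : i = 1 := by omega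
      exact h1p m L₀ hL₀ L' hL'
    · exact silent_tail_sums hKL (hL2 i (by omega) (by omega) (by omega)) m _ _
  · rcases Nat.lt_or_ge i 2 with hi | hi
    · exact Or.inl (by omega)
    · exact Or.inr (Or.inl fun m l => kernel_zero hKL (hL2 i (by omega) (by omega) (by omega)) m l)

end Summit.QuantumFields.BalabanUV.Beta.EriceRemainderEnclosureHistoryAutonomyComparisonAgeCompositionDecayHorizon

end
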